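/-
Copyright (c) 2026 the pub-hodgecm-mathlib formalisation cell (harness21).  Prover seat hodgecm-mathlib-K2Liu-p10 (g2), Track B «K2-LIT»,
#184♮ = hLiu418 = `stmt-HodgeConjecture-24832`; LEAD F0P6-plan (g12) deals 2026-09-04T07:20:45Z (c) ∕ 07:29:53Z (b), SIGS-RoadI-v3 §Hol
row Hol-2b «ADELIC SENTENCE», file 2∕2.  THEOREMS ONLY (no `def`, no `instance`, no named-fact hypothesis, no `sorry`).
-/
import Summits.HodgeConjecture.HodgeConjecture.Theorems.K2LiuHolTubeRigidityOfFrame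
import Summits.HodgeConjecture.HodgeConjecture.Theorems.K2LiuSiegelFourierExpansionDelta
import HarnessLib

/-!
# Crux `HLiu418`, Road I, organ Hol-2b: THE ADELIC SENTENCE Hol.3(c) — a continuous left-`H(L⁺)`-invariant `F` on `H(𝔸)` of
# holomorphic type with a non-zero scalar weight, ALL of whose non-constant Fourier coefficients along `N_Δ` vanish, is ZERO

Cell `hodgecm-mathlib`, crux item hLiu418 = `stmt-HodgeConjecture-24832` (helper lane, count-neutral).  Assembly of ★ Hol-2b CORE
`K2LiuHolTubeRigidity.eq_zero_of_hol_of_transl_invariant` (tube currency, through ★ `K2LiuHolTubeRigidityOfFrame.eq_zero_of_hol_of_frame`) with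
★ Φ1 `K2LiuSiegelFourierExpansionDelta.hasSum_fourierCoeffDelta{,_mul_unipDeltaChar}` (Fourier expansion along `N_Δ(L⁺)\N_Δ(𝔸)`), the (E2)
bridge ★ `mem_unipDeltaArch_iff_forall_archAt`, the H1-C frames ★ `exists_tubeFrame_arch₂` ∕ ★ `K2LiuHermitianTubeFrameWeyl.exists_tubeFrame_arch₃`
(consumed BY VALUE: ONE frame `(T_w, T_w⁻¹)` per complex place `w`, its clauses as hypotheses, its frame map `Fr` with defining equation `hFr` —
the assembly U5 `choose`s once and feeds H1-E and this file alike), the split ★ `UnitaryGroupAdelicProduct` (`h = (h_∞, 1)·(1, h_f)`), and the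
rational Weyl element ★ `weylDelta = ι(1, −1) ∈ H(L⁺)`.  The (E0)(E1) inputs are H1-E's output face on the tube-side avatar
`Φ : H(𝔸_f) → (σ → M_{2n}(ℂ)) → ℂ` (★ core binders VERBATIM) tied to `F` by ONE link hypothesis `hΦ : Φ x (Fr a) = F ((a, 1)·(1, x))`.
* §1 **`apply_unipDelta_mul_of_fourierCoeffDelta_eq_zero`** — Φ1 ⇒ (E2)-adelic: if every Fourier coefficient `φ_S(h)`, `S ≠ 0`, of a
  continuous left-`N_Δ(L⁺)`-invariant `F` vanishes, then `F(u h) = F(h)` for all `u ∈ N_Δ(𝔸)` (finite support ⇒ summable; expand at `u` and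
  at `1`; `ψ_0 ≡ 1`).
* §2 **`eq_zero_of_fourierCoeffDelta_eq_zero_of_symmetry`** (a symmetry `γ₀ ∈ H(𝔸)` of `F` with non-constant framed cocycle, by value) and
  **`eq_zero_of_fourierCoeffDelta_eq_zero`** (`γ₀ = w_Δ` through the Weyl clause (vii); `0 < n`, some `k_w ≠ 0`, ★ `exists_det_zpow_prod_ne`):
  OUTPUT = organ U2's `hdet` ∕ Hol.3(c) («all non-constant `fourierCoeffDelta` vanish ⇒ `F = 0`»; ★ `K2LiuRankOneCoefficientComparison.rankOneRigidity`
  reads it pointwise; index currency = Φ1's `skewMatrices`).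
NO Whitehead lemma, NO weak approximation, NO Koecher principle.
Sources: [Shimura1997, §§5–6, §18.1]; [MoeglinWaldspurger1995, I.2.6]; [KudlaRallis1994, §3]; [BorelJacquet1979, §4.1].
HONEST LABEL.  Helper lemmas, count-neutral; `HC_CM` is proved only modulo the 7 printed citations (2 remaining named inputs:
hLiu418 = `stmt-HodgeConjecture-24832`, h413 = `stmt-HodgeConjecture-24833`) until rung 0 closes.
-/

set_option autoImplicit false
set_option linter.dupNamespace false -- the mandated namespace repeats `HodgeConjecture.HodgeConjecture`

noncomputable section

namespace Summit.HodgeConjecture.HodgeConjecture.Cruxes.HLiu418.K2LiuHolFourierRigidityOfResidue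

open Matrix Complex Set Filter
open scoped MatrixGroups ComplexOrder Topology BigOperators ENNReal
open NumberField NumberField.InfinitePlace IsDedekindDomain MeasureTheory MeasureTheory.Measure
open Literature.NumberTheory.ModularForms.SiegelUpperHalfSpace (num denom moeb)
open Literature.AlgebraicGeometry.ShimuraVarieties.KudlaRapoport2013.Sec11Sec12MainTheorem (hermUpperHalfSpace)
open Literature.NumberTheory.Automorphic Literature.NumberTheory.Automorphic.UnitaryGroup
open Literature.NumberTheory.GelbartRogawski1991 Literature.NumberTheory.GelbartRogawski1991.GRConstruction
open Literature.NumberTheory.K2Lit.SiegelDoubled Literature.MeasureTheory.Group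
open K2LiuHermitianTubeCocycle K2LiuHermitianTubeAction K2LiuHolTubeRigidity K2LiuHolTubeRigidityOfFrame
open K2LiuSiegelUnipotentFourierDefs K2LiuSiegelUnipotentCharacters K2LiuSiegelFourierCoeffDelta K2LiuSiegelFourierExpansionDelta
  K2LiuSiegelUnipotentLocalDefs K2LiuSiegelUnipotentArchPlaces K2LiuWeylDeltaRational

/-! ## 1. Φ1 ⇒ (E2)-adelic: vanishing non-constant coefficients make `F` left-`N_Δ(𝔸)`-invariant -/

section Unipotent

variable (L : Type) [Field L] [NumberField L] [IsCMField L] {N M n : ℕ} (e : Fin N × Fin M ≃ Fin n)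
  (dV : Fin N → L) (hdV : ∀ i, IsCMField.complexConj L (dV i) = dV i)
  (dW : Fin M → L) (hdW : ∀ i, IsCMField.complexConj L (dW i) = dW i)
variable [MeasurableSpace (unipDelta L e dV hdV dW hdW)] [BorelSpace (unipDelta L e dV hdV dW hdW)]

/-- **(E2), adelic form.**  If `F : H(𝔸) → ℂ` is continuous and left-`N_Δ(L⁺)`-invariant and ALL its Fourier coefficients `φ_S(h)` along
`N_Δ(L⁺)\N_Δ(𝔸)` with `S ≠ 0` vanish (every `h`), then `F(u h) = F(h)` for every `u ∈ N_Δ(𝔸)`: by ★ Φ1 both `F(u h)` and `F(h)` equal the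
constant coefficient `φ_0(h)` (`ψ_0 ≡ 1`; the coefficient family has finite support, so it is summable).
[cite: MoeglinWaldspurger1995, I.2.6] [cite: Shimura1997, §18.1] -/
theorem apply_unipDelta_mul_of_fourierCoeffDelta_eq_zero (hdV0 : ∀ i, dV i ≠ 0) (hdW0 : ∀ i, dW i ≠ 0)
    (νN : Measure (unipDelta L e dV hdV dW hdW)) [νN.IsMulLeftInvariant]
    {β : unipDelta L e dV hdV dW hdW → ℝ≥0∞} (hβ : IsCoveringWeight (unipDeltaRat L e dV hdV dW hdW) β)
    (hβ0 : ∫⁻ u, β u ∂νN ≠ 0) (hβtop : ∫⁻ u, β u ∂νN ≠ ∞)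
    {F : HA L e dV hdV dW hdW → ℂ} (hFc : Continuous F)
    (hFN : ∀ (γ : unipDeltaRat L e dV hdV dW hdW) (h : HA L e dV hdV dW hdW),
      F ((((γ : unipDelta L e dV hdV dW hdW) : HA L e dV hdV dW hdW)) * h) = F h)
    (hcoef : ∀ S : skewMatrices ((IsCMField.complexConj L : L ≃ₐ[Fp L] L) : L →+* L) ((gramR L e dV hdV dW hdW).map (algebraMap (Fp L) L)),
      S ≠ 0 → ∀ h, fourierCoeffDelta L e dV hdV dW hdW νN β (S : Matrix (Fin n) (Fin n) L) F h = 0)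
    {u : HA L e dV hdV dW hdW} (hu : u ∈ unipDelta L e dV hdV dW hdW) (h : HA L e dV hdV dW hdW) : F (u * h) = F h := by
  have hφc : Continuous fun v : unipDelta L e dV hdV dW hdW => F ((v : HA L e dV hdV dW hdW) * h) :=
    hFc.comp (continuous_subtype_val.mul continuous_const)
  have hφ : ∀ (γ : unipDeltaRat L e dV hdV dW hdW) (v : unipDelta L e dV hdV dW hdW),
      F ((((γ : unipDelta L e dV hdV dW hdW) * v : unipDelta L e dV hdV dW hdW) : HA L e dV hdV dW hdW) * h) =
        F ((v : HA L e dV hdV dW hdW) * h) := fun γ v => by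
    rw [Subgroup.coe_mul, mul_assoc, hFN]
  -- the coefficient family vanishes off `S = 0`, hence is summable
  have hzero : ∀ S : skewMatrices ((IsCMField.complexConj L : L ≃ₐ[Fp L] L) : L →+* L) ((gramR L e dV hdV dW hdW).map (algebraMap (Fp L) L)),
      S ≠ 0 → fourierCoeffDelta L e dV hdV dW hdW νN β (S : Matrix (Fin n) (Fin n) L) F h = 0 := fun S hS => hcoef S hS h
  have hsum : Summable fun S : skewMatrices ((IsCMField.complexConj L : L ≃ₐ[Fp L] L) : L →+* L)
      ((gramR L e dV hdV dW hdW).map (algebraMap (Fp L) L)) => ‖fourierCoeffDelta L e dV hdV dW hdW νN β (S : Matrix (Fin n) (Fin n) L) F h‖ := by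
    refine summable_of_ne_finset_zero (s := {0}) fun S hS => ?_
    rw [Finset.mem_singleton] at hS
    rw [hzero S hS, norm_zero]
  -- the expansion at `u` and at `1`
  have hexp := hasSum_fourierCoeffDelta_mul_unipDeltaChar L e dV hdV dW hdW hdV0 hdW0 νN hβ hβ0 hβtop hφc hφ hsum ⟨u, hu⟩
  have hexp1 := hasSum_fourierCoeffDelta L e dV hdV dW hdW hdV0 hdW0 νN hβ hβ0 hβtop hφc hφ hsum
  have hsingle : HasSum (fun S : skewMatrices ((IsCMField.complexConj L : L ≃ₐ[Fp L] L) : L →+* L) ((gramR L e dV hdV dW hdW).map (algebraMap (Fp L) L)) =>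
      fourierCoeffDelta L e dV hdV dW hdW νN β (S : Matrix (Fin n) (Fin n) L) F h *
        (unipDeltaChar L e dV hdV dW hdW (S : Matrix (Fin n) (Fin n) L) ((⟨u, hu⟩ : unipDelta L e dV hdV dW hdW) : HA L e dV hdV dW hdW) : ℂ))
      (fourierCoeffDelta L e dV hdV dW hdW νN β ((0 : skewMatrices ((IsCMField.complexConj L : L ≃ₐ[Fp L] L) : L →+* L)
        ((gramR L e dV hdV dW hdW).map (algebraMap (Fp L) L))) : Matrix (Fin n) (Fin n) L) F h *
        (unipDeltaChar L e dV hdV dW hdW ((0 : skewMatrices ((IsCMField.complexConj L : L ≃ₐ[Fp L] L) : L →+* L)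
          ((gramR L e dV hdV dW hdW).map (algebraMap (Fp L) L))) : Matrix (Fin n) (Fin n) L)
          ((⟨u, hu⟩ : unipDelta L e dV hdV dW hdW) : HA L e dV hdV dW hdW) : ℂ)) :=
    hasSum_single 0 fun S hS => by rw [hzero S hS, zero_mul]
  have hsingle1 : HasSum (fun S : skewMatrices ((IsCMField.complexConj L : L ≃ₐ[Fp L] L) : L →+* L) ((gramR L e dV hdV dW hdW).map (algebraMap (Fp L) L)) =>
      fourierCoeffDelta L e dV hdV dW hdW νN β (S : Matrix (Fin n) (Fin n) L) F h)
      (fourierCoeffDelta L e dV hdV dW hdW νN β ((0 : skewMatrices ((IsCMField.complexConj L : L ≃ₐ[Fp L] L) : L →+* L)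
        ((gramR L e dV hdV dW hdW).map (algebraMap (Fp L) L))) : Matrix (Fin n) (Fin n) L) F h) :=
    hasSum_single 0 fun S hS => hzero S hS
  have h1 := hexp.unique hsingle
  have h2 := hexp1.unique hsingle1
  rw [ZeroMemClass.coe_zero, unipDeltaChar_zero, Circle.coe_one, mul_one] at h1
  rw [ZeroMemClass.coe_zero] at h2
  change F (u * h) = _ at h1
  rw [h1, h2]

end Unipotent

section Adelic

variable (L : Type) [Field L] [NumberField L] [IsCMField L] {N M n : ℕ} (e : Fin N × Fin M ≃ Fin n)
  (dV : Fin N → L) (hdV : ∀ i, IsCMField.complexConj L (dV i) = dV i)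
  (dW : Fin M → L) (hdW : ∀ i, IsCMField.complexConj L (dW i) = dW i)
  (T Tinv : {w : InfinitePlace L // w.IsComplex} → Matrix (Fin n ⊕ Fin n) (Fin n ⊕ Fin n) ℂ)
  (Fr : UnitaryGroup.arch (Fp L) L (IsCMField.complexConj L) (n + n) (hermD L e dV hdV dW hdW) →
    {w : InfinitePlace L // w.IsComplex} → Matrix (Fin n ⊕ Fin n) (Fin n ⊕ Fin n) ℂ)
  (hFr : ∀ a w, Fr a w = T w * Matrix.reindex (e₂ (n := n)).symm (e₂ (n := n)).symm
    (((UnitaryGroup.archAt (Fp L) L (IsCMField.complexConj L) (n + n) (hermD L e dV hdV dW hdW) w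
      (UnitaryGroup.complexConj_smul_infinitePlace L w.1) (IsCMField.complexConj_ne_one L) a :
        UnitaryGroup.archLocal L (n + n) (hermD L e dV hdV dW hdW) w) : GL (Fin (n + n)) ℂ) : Matrix (Fin (n + n)) (Fin (n + n)) ℂ) * Tinv w)
  (hT2 : ∀ w, Tinv w * T w = 1)
  (hTU : ∀ w (g : GL (Fin (n + n)) ℂ), g ∈ UnitaryGroup.archLocal L (n + n) (hermD L e dV hdV dW hdW) w →
    (T w * Matrix.reindex (e₂ (n := n)).symm (e₂ (n := n)).symm (g : Matrix _ _ ℂ) * Tinv w)ᴴ * Matrix.J (Fin n) ℂ *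
      (T w * Matrix.reindex (e₂ (n := n)).symm (e₂ (n := n)).symm (g : Matrix _ _ ℂ) * Tinv w) = Matrix.J (Fin n) ℂ)
  (hTN : ∀ w (b : Matrix (Fin n) (Fin n) ℂ), bᴴ = b → ∃ u : GL (Fin (n + n)) ℂ,
    u ∈ UnitaryGroup.archLocal L (n + n) (hermD L e dV hdV dW hdW) w ∧ IsUnipM (n := n) (u : Matrix (Fin (n + n)) (Fin (n + n)) ℂ) ∧
      T w * Matrix.reindex (e₂ (n := n)).symm (e₂ (n := n)).symm (u : Matrix _ _ ℂ) * Tinv w = fromBlocks 1 b 0 1)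
  (hTS : ∀ w (P : Matrix (Fin n ⊕ Fin n) (Fin n ⊕ Fin n) ℂ), Pᴴ * Matrix.J (Fin n) ℂ * P = Matrix.J (Fin n) ℂ →
    ∃ g : GL (Fin (n + n)) ℂ, g ∈ UnitaryGroup.archLocal L (n + n) (hermD L e dV hdV dW hdW) w ∧
      T w * Matrix.reindex (e₂ (n := n)).symm (e₂ (n := n)).symm (g : Matrix _ _ ℂ) * Tinv w = P)

/-! ## 2. The adelic sentence -/

variable [MeasurableSpace (unipDelta L e dV hdV dW hdW)] [BorelSpace (unipDelta L e dV hdV dW hdW)]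
  [Fintype {w : InfinitePlace L // w.IsComplex}]

include hFr hT2 hTU hTN hTS in
/-- **Hol.3(c), ADELIC SENTENCE, by-value symmetry.**  DATA: non-degenerate doubled datum; Haar data `νN, β` of ★ Φ1; weights
`k : {w ∣ ∞} → ℤ`; ONE per-place tube frame `(T_w, T_w⁻¹)` with clauses (i)(ii)(iii)(iv′)(vi) of ★ `exists_tubeFrame_arch₂∕₃` and its frame
map `Fr` (`hFr`); `F : H(𝔸) → ℂ` continuous, left-`N_Δ(L⁺)`-invariant; a symmetry `γ₀ ∈ H(𝔸)` of `F` whose framed cocycle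
`∏_w det(denom (Fr (γ₀)_∞ w) Z_w)^{k_w}` is NOT constant on `ℌ_n^σ`; the tube-side avatar `Φ` (link `hΦ`) and its holomorphic descent `f`
((E0) = ★ core dictionary VERBATIM, (E1) `hhol`) — H1-E's output face.  IF every Fourier coefficient `φ_S(h)`, `S ≠ 0`, of `F` vanishes,
THEN `F = 0`. [cite: Shimura1997, §§5–6] [cite: MoeglinWaldspurger1995, I.2.6] [cite: KudlaRallis1994, §3] -/
theorem eq_zero_of_fourierCoeffDelta_eq_zero_of_symmetry (hdV0 : ∀ i, dV i ≠ 0) (hdW0 : ∀ i, dW i ≠ 0)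
    (νN : Measure (unipDelta L e dV hdV dW hdW)) [νN.IsMulLeftInvariant]
    {β : unipDelta L e dV hdV dW hdW → ℝ≥0∞} (hβ : IsCoveringWeight (unipDeltaRat L e dV hdV dW hdW) β)
    (hβ0 : ∫⁻ u, β u ∂νN ≠ 0) (hβtop : ∫⁻ u, β u ∂νN ≠ ∞) (k : {w : InfinitePlace L // w.IsComplex} → ℤ)
    (F : HA L e dV hdV dW hdW → ℂ) (hFc : Continuous F)
    (hFN : ∀ (γ : unipDeltaRat L e dV hdV dW hdW) (h : HA L e dV hdV dW hdW),
      F ((((γ : unipDelta L e dV hdV dW hdW) : HA L e dV hdV dW hdW)) * h) = F h)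
    {γ₀ : HA L e dV hdV dW hdW} (hFγ : ∀ h, F (γ₀ * h) = F h)
    (hJ : ∃ Z W : {w : InfinitePlace L // w.IsComplex} → Matrix (Fin n) (Fin n) ℂ, (∀ s, Z s ∈ hermUpperHalfSpace n) ∧
      (∀ s, W s ∈ hermUpperHalfSpace n) ∧
      (∏ s, (denom (Fr (UnitaryGroup.archPart (Fp L) L (IsCMField.complexConj L) (n + n) (hermD L e dV hdV dW hdW) γ₀) s) (Z s)).det ^ k s) ≠
        ∏ s, (denom (Fr (UnitaryGroup.archPart (Fp L) L (IsCMField.complexConj L) (n + n) (hermD L e dV hdV dW hdW) γ₀) s) (W s)).det ^ k s)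
    (Φ : UnitaryGroup.finAdelic (Fp L) L (IsCMField.complexConj L) (n + n) (hermD L e dV hdV dW hdW) →
      ({w : InfinitePlace L // w.IsComplex} → Matrix (Fin n ⊕ Fin n) (Fin n ⊕ Fin n) ℂ) → ℂ)
    (hΦ : ∀ x a, Φ x (Fr a) = F ((UnitaryGroup.archToAdelic (Fp L) L (IsCMField.complexConj L) (n + n) (hermD L e dV hdV dW hdW) a *
      UnitaryGroup.finAdelicToAdelic (Fp L) L (IsCMField.complexConj L) (n + n) (hermD L e dV hdV dW hdW) x : HA L e dV hdV dW hdW)))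
    (f : UnitaryGroup.finAdelic (Fp L) L (IsCMField.complexConj L) (n + n) (hermD L e dV hdV dW hdW) →
      ({w : InfinitePlace L // w.IsComplex} → Matrix (Fin n) (Fin n) ℂ) → ℂ)
    (hE0 : ∀ x g, (∀ s, (g s)ᴴ * Matrix.J (Fin n) ℂ * g s = Matrix.J (Fin n) ℂ) →
      f x (fun s => moeb (g s) (I • 1)) = (∏ s, (denom (g s) (I • 1)).det ^ k s) * Φ x g)
    (hhol : ∀ x, DifferentiableOn ℂ (fun z : {w : InfinitePlace L // w.IsComplex} → Fin n → Fin n → ℂ => f x fun s => Matrix.of (z s))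
      {z | ∀ s, Matrix.of (z s) ∈ hermUpperHalfSpace n})
    (hcoef : ∀ S : skewMatrices ((IsCMField.complexConj L : L ≃ₐ[Fp L] L) : L →+* L) ((gramR L e dV hdV dW hdW).map (algebraMap (Fp L) L)),
      S ≠ 0 → ∀ h, fourierCoeffDelta L e dV hdV dW hdW νN β (S : Matrix (Fin n) (Fin n) L) F h = 0) :
    F = 0 := by
  -- (E2), adelic: `F` is left-`N_Δ(𝔸)`-invariant
  have hE2 : ∀ {u : HA L e dV hdV dW hdW}, u ∈ unipDelta L e dV hdV dW hdW → ∀ h, F (u * h) = F h := fun hu h =>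
    apply_unipDelta_mul_of_fourierCoeffDelta_eq_zero L e dV hdV dW hdW hdV0 hdW0 νN hβ hβ0 hβtop hFc hFN hcoef hu h
  -- `F` as a function of `(h_f, h_∞)`
  set F' : UnitaryGroup.finAdelic (Fp L) L (IsCMField.complexConj L) (n + n) (hermD L e dV hdV dW hdW) →
      UnitaryGroup.arch (Fp L) L (IsCMField.complexConj L) (n + n) (hermD L e dV hdV dW hdW) → ℂ := fun x a =>
    F ((UnitaryGroup.archToAdelic (Fp L) L (IsCMField.complexConj L) (n + n) (hermD L e dV hdV dW hdW) a *
      UnitaryGroup.finAdelicToAdelic (Fp L) L (IsCMField.complexConj L) (n + n) (hermD L e dV hdV dW hdW) x : HA L e dV hdV dW hdW)) with hF'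
  have hΦ' : ∀ x a, Φ x (Fr a) = F' x a := fun x a => by rw [hF', hΦ]
  -- unipotent invariance of `F'`
  have hN : ∀ x u a, (∀ s, ∃ b : Matrix (Fin n) (Fin n) ℂ, bᴴ = b ∧ Fr u s = fromBlocks 1 b 0 1) → F' x (u * a) = F' x a := by
    intro x u a hu
    simp only [hF', map_mul, mul_assoc]
    exact hE2 (archToAdelic_mem_unipDelta_of_frame L e dV hdV dW hdW T Tinv Fr hFr hT2 hTN hu) _
  -- the symmetry `γ₀`: `F' x ((γ₀)_∞ a) = F' ((γ₀)_f⁻¹ x) a`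
  have hγ : ∀ x a, F' x (UnitaryGroup.archPart (Fp L) L (IsCMField.complexConj L) (n + n) (hermD L e dV hdV dW hdW) γ₀ * a) =
      F' ((UnitaryGroup.finPart (Fp L) L (IsCMField.complexConj L) (n + n) (hermD L e dV hdV dW hdW) γ₀)⁻¹ * x) a := by
    intro x a
    simp only [hF', map_mul, map_inv]
    -- work in the datum-typed copy `g₀` of `γ₀` (same term; keeps every product in one carrier)
    set g₀ : (UnitaryGroup.adelicGroupData (Fp L) L (IsCMField.complexConj L) (n + n) (hermD L e dV hdV dW hdW)).Adelic := γ₀ with hg₀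
    have hFγ' : ∀ g : (UnitaryGroup.adelicGroupData (Fp L) L (IsCMField.complexConj L) (n + n) (hermD L e dV hdV dW hdW)).Adelic,
        F (g₀ * g) = F g := fun g => hFγ g
    have hsplit := UnitaryGroup.archToAdelic_mul_finAdelicToAdelic (Fp L) L (IsCMField.complexConj L) (n + n) (hermD L e dV hdV dW hdW) g₀
    have hcomm := (UnitaryGroup.commute_archToAdelic_finAdelicToAdelic (Fp L) L (IsCMField.complexConj L) (n + n) (hermD L e dV hdV dW hdW) a
      (UnitaryGroup.finPart (Fp L) L (IsCMField.complexConj L) (n + n) (hermD L e dV hdV dW hdW) g₀)⁻¹).eq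
    rw [map_inv] at hcomm
    have key : UnitaryGroup.archToAdelic (Fp L) L (IsCMField.complexConj L) (n + n) (hermD L e dV hdV dW hdW)
        (UnitaryGroup.archPart (Fp L) L (IsCMField.complexConj L) (n + n) (hermD L e dV hdV dW hdW) g₀) =
        g₀ * (UnitaryGroup.finAdelicToAdelic (Fp L) L (IsCMField.complexConj L) (n + n) (hermD L e dV hdV dW hdW)
          (UnitaryGroup.finPart (Fp L) L (IsCMField.complexConj L) (n + n) (hermD L e dV hdV dW hdW) g₀))⁻¹ := by
      rw [eq_mul_inv_iff_mul_eq]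
      exact hsplit
    rw [key, mul_assoc, mul_assoc, ← mul_assoc _ (UnitaryGroup.archToAdelic (Fp L) L (IsCMField.complexConj L) (n + n) (hermD L e dV hdV dW hdW) a),
      ← hcomm, mul_assoc]
    exact hFγ' _
  -- rigidity through the frame
  have hzero : ∀ x a, F' x a = 0 := fun x a =>
    eq_zero_of_hol_of_frame Fr (frame_mul L e dV hdV dW hdW T Tinv Fr hFr hT2) (frame_mem L e dV hdV dW hdW T Tinv Fr hFr hTU)
      (frame_surj L e dV hdV dW hdW T Tinv Fr hFr hTS) k F' Φ hΦ' f hE0 hN hhol hγ hJ x a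
  funext h
  have hh := UnitaryGroup.archToAdelic_mul_finAdelicToAdelic (Fp L) L (IsCMField.complexConj L) (n + n) (hermD L e dV hdV dW hdW) h
  have := hzero (UnitaryGroup.finPart (Fp L) L (IsCMField.complexConj L) (n + n) (hermD L e dV hdV dW hdW) h)
    (UnitaryGroup.archPart (Fp L) L (IsCMField.complexConj L) (n + n) (hermD L e dV hdV dW hdW) h)
  simp only [hF'] at this
  rw [hh] at this
  exact this

include hFr hT2 hTU hTN hTS in
/-- **Hol.3(c), THE ADELIC SENTENCE** (organ U2's `hdet`, read pointwise by ★ `K2LiuRankOneCoefficientComparison.rankOneRigidity`).  Non-degenerate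
doubled datum with `0 < n`; Haar data `νN, β` (★ Φ1); weights `k` with SOME `k_w ≠ 0`; ONE per-place tube frame with clauses (i)–(iv′)(vi) AND the Weyl
clause (vii) `T_w·diag(1,−1)·T_w⁻¹ = (0 B; C 0)`, `IsUnit C.det` (★ `exists_tubeFrame_arch₃`); `F : H(𝔸) → ℂ` continuous and LEFT-`H(L⁺)`-INVARIANT
with tube-side avatar `Φ` and holomorphic descent `f` of weight `k` ((E0)(E1), H1-E's face by value).  IF all Fourier coefficients `φ_S(h)` of `F`
along `N_Δ(L⁺)\N_Δ(𝔸)` with `S ≠ 0` vanish, THEN `F = 0`.  (Φ1 ⇒ `F` left-`N_Δ(𝔸)`-invariant ⇒ `f` invariant under all hermitian translations ⇒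
constant (★ (H′)) ⇒ `0` by the non-constant cocycle `∏_w (det C_w · det Z_w)^{k_w}` of the rational Weyl element `w_Δ = ι(1,−1)`, ★
`exists_det_zpow_prod_ne`.)  CONSUMER (organ U2, ★ `K2LiuRankOneCoefficientComparison.rankOneRigidity`), binder quoted verbatim:
`(hdet : ∀ y ∈ P, (∀ β : Matrix (Fin 2) (Fin 2) L, (β.map (IsCMField.complexConj L))ᵀ = β → β ≠ 0 → coeff β y = 0) → y = 0)`; the one-line
U5 adapter: `P` := the value class of continuous left-`H(L⁺)`-invariant `y` carrying a descent `(Φ, f, hΦ, hE0, hhol)` of weight `k`, `coeff β` :=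
`fourierCoeffDelta νN β_wt (S β) ·` for U5's index dictionary `S : Herm₂(L) ≃ skewMatrices …` (`β ≠ 0 ↔ S β ≠ 0`), and
`hdet y hy h0 := eq_zero_of_fourierCoeffDelta_eq_zero … (fun S hS h => by simpa using congrFun (h0 (S⁻¹…) … ) h)`-shape.
[cite: Shimura1997, §§5–6] [cite: MoeglinWaldspurger1995, I.2.6] [cite: KudlaRallis1994, §3] -/
theorem eq_zero_of_fourierCoeffDelta_eq_zero (hdV0 : ∀ i, dV i ≠ 0) (hdW0 : ∀ i, dW i ≠ 0) (hn : 0 < n)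
    (νN : Measure (unipDelta L e dV hdV dW hdW)) [νN.IsMulLeftInvariant]
    {β : unipDelta L e dV hdV dW hdW → ℝ≥0∞} (hβ : IsCoveringWeight (unipDeltaRat L e dV hdV dW hdW) β)
    (hβ0 : ∫⁻ u, β u ∂νN ≠ 0) (hβtop : ∫⁻ u, β u ∂νN ≠ ∞) (k : {w : InfinitePlace L // w.IsComplex} → ℤ) (hk : ∃ w, k w ≠ 0)
    (hTW : ∀ w, ∃ B C : Matrix (Fin n) (Fin n) ℂ, IsUnit C.det ∧ T w * fromBlocks 1 0 0 (-1) * Tinv w = fromBlocks 0 B C 0)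
    (F : HA L e dV hdV dW hdW → ℂ) (hFc : Continuous F) (hFrat : ∀ γ ∈ ratH L e dV hdV dW hdW, ∀ h, F (γ * h) = F h)
    (Φ : UnitaryGroup.finAdelic (Fp L) L (IsCMField.complexConj L) (n + n) (hermD L e dV hdV dW hdW) →
      ({w : InfinitePlace L // w.IsComplex} → Matrix (Fin n ⊕ Fin n) (Fin n ⊕ Fin n) ℂ) → ℂ)
    (hΦ : ∀ x a, Φ x (Fr a) = F ((UnitaryGroup.archToAdelic (Fp L) L (IsCMField.complexConj L) (n + n) (hermD L e dV hdV dW hdW) a *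
      UnitaryGroup.finAdelicToAdelic (Fp L) L (IsCMField.complexConj L) (n + n) (hermD L e dV hdV dW hdW) x : HA L e dV hdV dW hdW)))
    (f : UnitaryGroup.finAdelic (Fp L) L (IsCMField.complexConj L) (n + n) (hermD L e dV hdV dW hdW) →
      ({w : InfinitePlace L // w.IsComplex} → Matrix (Fin n) (Fin n) ℂ) → ℂ)
    (hE0 : ∀ x g, (∀ s, (g s)ᴴ * Matrix.J (Fin n) ℂ * g s = Matrix.J (Fin n) ℂ) →
      f x (fun s => moeb (g s) (I • 1)) = (∏ s, (denom (g s) (I • 1)).det ^ k s) * Φ x g)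
    (hhol : ∀ x, DifferentiableOn ℂ (fun z : {w : InfinitePlace L // w.IsComplex} → Fin n → Fin n → ℂ => f x fun s => Matrix.of (z s))
      {z | ∀ s, Matrix.of (z s) ∈ hermUpperHalfSpace n})
    (hcoef : ∀ S : skewMatrices ((IsCMField.complexConj L : L ≃ₐ[Fp L] L) : L →+* L) ((gramR L e dV hdV dW hdW).map (algebraMap (Fp L) L)),
      S ≠ 0 → ∀ h, fourierCoeffDelta L e dV hdV dW hdW νN β (S : Matrix (Fin n) (Fin n) L) F h = 0) :
    F = 0 := by
  classical
  -- the framed cocycle of `w_Δ` is `∏_w (det C_w · det Z_w)^{k_w}`, non-constant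
  choose B C hC hBC using hTW
  have hden : ∀ w (Z : Matrix (Fin n) (Fin n) ℂ),
      (denom (Fr (UnitaryGroup.archPart (Fp L) L (IsCMField.complexConj L) (n + n) (hermD L e dV hdV dW hdW) (weylDelta L e dV hdV dW hdW)) w) Z).det =
        (C w).det * Z.det := by
    intro w Z
    rw [frame_archPart_weylDelta L e dV hdV dW hdW T Tinv Fr hFr, hBC w, Literature.NumberTheory.ModularForms.SiegelUpperHalfSpace.denom_fromBlocks,
      add_zero, det_mul]
  obtain ⟨w₀, hw₀⟩ := hk
  obtain ⟨Z, W, hZ, hW, hne⟩ := exists_det_zpow_prod_ne (σ := {w : InfinitePlace L // w.IsComplex}) hn (k := k) hw₀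
  have hJ : ∃ Z W : {w : InfinitePlace L // w.IsComplex} → Matrix (Fin n) (Fin n) ℂ, (∀ s, Z s ∈ hermUpperHalfSpace n) ∧
      (∀ s, W s ∈ hermUpperHalfSpace n) ∧
      (∏ s, (denom (Fr (UnitaryGroup.archPart (Fp L) L (IsCMField.complexConj L) (n + n) (hermD L e dV hdV dW hdW) (weylDelta L e dV hdV dW hdW)) s)
          (Z s)).det ^ k s) ≠
        ∏ s, (denom (Fr (UnitaryGroup.archPart (Fp L) L (IsCMField.complexConj L) (n + n) (hermD L e dV hdV dW hdW) (weylDelta L e dV hdV dW hdW)) s)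
          (W s)).det ^ k s := by
    refine ⟨Z, W, hZ, hW, fun heq => hne ?_⟩
    simp only [hden, mul_zpow, Finset.prod_mul_distrib, denom_J] at heq ⊢
    have hC0 : (∏ s, (C s).det ^ k s) ≠ 0 := Finset.prod_ne_zero_iff.2 fun s _ => zpow_ne_zero _ (hC s).ne_zero
    exact mul_left_cancel₀ hC0 heq
  exact eq_zero_of_fourierCoeffDelta_eq_zero_of_symmetry L e dV hdV dW hdW T Tinv Fr hFr hT2 hTU hTN hTS hdV0 hdW0 νN hβ hβ0 hβtop k F hFc
    (fun γ h => hFrat _ ((mem_unipDeltaRat_iff L e dV hdV dW hdW _).1 γ.2) h)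
    (fun h => hFrat _ (weylDelta_mem_ratH L e dV hdV dW hdW) h) hJ Φ hΦ f hE0 hhol hcoef

end Adelic

end Summit.HodgeConjecture.HodgeConjecture.Cruxes.HLiu418.K2LiuHolFourierRigidityOfResidue

end
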